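import Mathlib.Analysis.SpecialFunctions.ImproperIntegrals
import Mathlib.MeasureTheory.Integral.ExpDecay
import Mathlib.MeasureTheory.Integral.IntegralEqImproper
import HarnessLib

/-!
# Truncated Laplace integrals `∫_p^∞ e^{−at} dt`, `∫_p^∞ t e^{−at} dt` (CKMRV §5.1, (5.4))

Cohn–Kumar–Miller–Radchenko–Viazovska, Ann. of Math. 196 (2022) = arXiv:1902.05438, §5.1: the
"high" part of the generating function is computed in closed form,
`F_{2,high}(τ,r) = 4 sin²(πr²/2) ∫_p^∞ 𝒢(τ,it) e^{−πr²t} dt`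
`  = (4 sin²(πr²/2)/π) Σ_{k=−1}^{0} e^{−pπ(2k+r²)} ( 𝒢_{k,0}(τ)/(2k+r²) + i(1 + 2kpπ + pπr²)𝒢_{k,1}(τ)/(π(2k+r²)²) )`,
since `𝒢(τ, z) = Σ_{k,j} z^j e^{2πikz} 𝒢_{k,j}(τ)` and, for `Re a > 0`,
`∫_p^∞ e^{−at} dt = e^{−ap}/a`, `∫_p^∞ t e^{−at} dt = e^{−ap}(1 + ap)/a²`.

PROVED here (complex `a` with `Re a > 0`, real `p`): `integral_Ioi_cexp_neg_mul`,
`integrableOn_Ioi_mul_cexp_neg_mul`, `integral_Ioi_mul_cexp_neg_mul`, and the two CKMRV instances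
with `a = π(2k + r²)` (`integral_Ioi_gaussianLaplace`, `integral_Ioi_mul_gaussianLaplace`).

## References

* H. Cohn, A. Kumar, S. D. Miller, D. Radchenko, M. Viazovska, Ann. of Math. 196 (2022),
  arXiv:1902.05438, §5.1 (5.4). [CohnEtAl2019]
-/

noncomputable section

open Real Complex MeasureTheory Set Filter Topology Asymptotics

namespace Literature.Analysis.Fourier

/-- `∫_p^∞ e^{−at} dt = e^{−ap}/a` for `Re a > 0`. [folklore] -/
theorem integral_Ioi_cexp_neg_mul {a : ℂ} (ha : 0 < a.re) (p : ℝ) :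
    ∫ t : ℝ in Ioi p, cexp (-a * t) = cexp (-a * p) / a := by
  have h := integral_exp_mul_complex_Ioi (a := -a) (by simpa using ha) p
  rw [h, neg_div_neg_eq]

/-- `t ↦ t e^{−at}` is integrable on `(p, ∞)` for `Re a > 0`. [folklore] -/
theorem integrableOn_Ioi_mul_cexp_neg_mul {a : ℂ} (ha : 0 < a.re) (p : ℝ) :
    IntegrableOn (fun t : ℝ => (t : ℂ) * cexp (-a * t)) (Ioi p) := by
  have hcont : Continuous fun t : ℝ => (t : ℂ) * cexp (-a * t) := by fun_prop
  refine (integrable_norm_iff hcont.aestronglyMeasurable).mp ?_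
  -- `‖t e^{−at}‖ = |t| e^{−(Re a) t} = O(e^{−(Re a/2) t})`
  have hnorm : ∀ t : ℝ, ‖(t : ℂ) * cexp (-a * t)‖ = |t| * rexp (-a.re * t) := by
    intro t
    rw [norm_mul, Complex.norm_real, Real.norm_eq_abs, Complex.norm_exp]
    congr 1
    simp [Complex.mul_re]
  refine integrable_of_isBigO_exp_neg (b := a.re / 2) (by linarith) (hcont.norm.continuousOn) ?_
  simp_rw [hnorm]
  -- `|t| e^{−bt} = (|t| e^{−bt/2}) · e^{−bt/2}` with the first factor tending to `0`
  have hlim : Tendsto (fun t : ℝ => |t| * rexp (-(a.re / 2) * t)) atTop (𝓝 0) := by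
    have h1 := (tendsto_pow_mul_exp_neg_atTop_nhds_zero 1).comp (tendsto_id.const_mul_atTop (by linarith : 0 < a.re / 2))
    have h2 : Tendsto (fun t : ℝ => (a.re / 2)⁻¹ * ((a.re / 2 * t) ^ 1 * rexp (-(a.re / 2 * t)))) atTop (𝓝 ((a.re / 2)⁻¹ * 0)) :=
      h1.const_mul _
    rw [mul_zero] at h2
    refine (h2.congr' ?_)
    filter_upwards [eventually_ge_atTop 0] with t ht
    rw [abs_of_nonneg ht]
    field_simp
  have hbdd := hlim.isBigO_one ℝ
  have := hbdd.mul (isBigO_refl (fun t : ℝ => rexp (-(a.re / 2) * t)) atTop)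
  simp only [one_mul] at this
  refine this.congr' ?_ EventuallyEq.rfl
  filter_upwards with t
  rw [mul_assoc, ← Real.exp_add]
  congr 2; ring

/-- **`∫_p^∞ t e^{−at} dt = e^{−ap}(1 + ap)/a²`** for `Re a > 0`. [folklore] -/
theorem integral_Ioi_mul_cexp_neg_mul {a : ℂ} (ha : 0 < a.re) (p : ℝ) :
    ∫ t : ℝ in Ioi p, (t : ℂ) * cexp (-a * t) = cexp (-a * p) * (1 + a * p) / a ^ 2 := by
  have ha0 : a ≠ 0 := fun h => by simp [h] at ha
  -- antiderivative `G(t) = −e^{−at}(1 + at)/a²`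
  set G : ℝ → ℂ := fun t => -(cexp (-a * t) * (1 + a * t)) / a ^ 2 with hG
  have hderiv : ∀ t : ℝ, HasDerivAt G ((t : ℂ) * cexp (-a * t)) t := by
    intro t
    have h1 : HasDerivAt (fun s : ℝ => cexp (-a * s)) (cexp (-a * t) * (-a)) t := by
      have := ((hasDerivAt_id (t : ℂ)).const_mul (-a)).cexp
      simpa using this.comp_ofReal
    have h2 : HasDerivAt (fun s : ℝ => (1 + a * (s : ℂ))) a t := by
      have := ((hasDerivAt_id (t : ℂ)).const_mul a).const_add 1
      simpa using this.comp_ofReal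
    have h3 : HasDerivAt (fun s : ℝ => -(cexp (-a * s) * (1 + a * s)) / a ^ 2)
        (-(cexp (-a * t) * (-a) * (1 + a * t) + cexp (-a * t) * a) / a ^ 2) t :=
      ((h1.mul h2).neg).div_const (a ^ 2)
    refine h3.congr_deriv ?_
    field_simp
    ring
  have hlim : Tendsto G atTop (𝓝 0) := by
    -- `‖G t‖ ≤ (e^{−Re a t} (1 + ‖a‖|t|))/‖a‖² → 0`
    have hb : Tendsto (fun t : ℝ => cexp (-a * t) * (1 + a * t)) atTop (𝓝 0) := by
      rw [tendsto_zero_iff_norm_tendsto_zero]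
      have hexp : ∀ t : ℝ, ‖cexp (-a * t)‖ = rexp (-a.re * t) := fun t => by
        rw [Complex.norm_exp]; congr 1; simp [Complex.mul_re]
      have h1 : Tendsto (fun t : ℝ => rexp (-a.re * t)) atTop (𝓝 0) := by
        have := (tendsto_exp_neg_atTop_nhds_zero).comp (tendsto_id.const_mul_atTop ha)
        refine this.congr fun t => ?_
        simp
      have h2 : Tendsto (fun t : ℝ => rexp (-a.re * t) * (‖a‖ * t)) atTop (𝓝 0) := by
        have h := (tendsto_pow_mul_exp_neg_atTop_nhds_zero 1).comp (tendsto_id.const_mul_atTop ha)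
        have h' : Tendsto (fun t : ℝ => (‖a‖ / a.re) * ((a.re * t) ^ 1 * rexp (-(a.re * t)))) atTop
            (𝓝 ((‖a‖ / a.re) * 0)) := h.const_mul _
        rw [mul_zero] at h'
        refine h'.congr' ?_
        filter_upwards with t
        field_simp
      have hsum := h1.add h2
      rw [add_zero] at hsum
      refine squeeze_zero' (Eventually.of_forall fun t => norm_nonneg _) ?_ hsum
      filter_upwards [eventually_ge_atTop 0] with t ht
      rw [norm_mul, hexp]
      have : ‖1 + a * (t : ℂ)‖ ≤ 1 + ‖a‖ * t := by
        refine (norm_add_le _ _).trans ?_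
        rw [norm_one, norm_mul, Complex.norm_real, Real.norm_eq_abs, abs_of_nonneg ht]
      calc rexp (-a.re * t) * ‖1 + a * (t : ℂ)‖ ≤ rexp (-a.re * t) * (1 + ‖a‖ * t) :=
            mul_le_mul_of_nonneg_left this (Real.exp_pos _).le
        _ = rexp (-a.re * t) + rexp (-a.re * t) * (‖a‖ * t) := by ring
    have := (hb.neg.div_const (a ^ 2))
    simp only [neg_zero, zero_div] at this
    exact this
  have hint := integrableOn_Ioi_mul_cexp_neg_mul ha p
  have key := integral_Ioi_of_hasDerivAt_of_tendsto (hderiv p).continuousAt.continuousWithinAt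
    (fun t _ => hderiv t) hint hlim
  rw [key, hG]
  simp only
  ring

/-- **CKMRV (5.4), `j = 0`**: `∫_p^∞ e^{−2πkt} e^{−πr²t} dt = e^{−pπ(2k+r²)}/(π(2k+r²))`
for `Re(2k + r²) > 0` (complex `r²`). [cite: CohnEtAl2019, §5.1 (5.4)] -/
theorem integral_Ioi_gaussianLaplace {k : ℤ} {rsq : ℂ} (h : 0 < (2 * (k : ℂ) + rsq).re) (p : ℝ) :
    ∫ t : ℝ in Ioi p, cexp (-2 * π * k * t) * cexp (-π * rsq * t) =
      cexp (-p * π * (2 * k + rsq)) / (π * (2 * k + rsq)) := by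
  have ha : 0 < ((π : ℂ) * (2 * k + rsq)).re := by
    rw [show ((π : ℂ) * (2 * k + rsq)).re = π * (2 * (k : ℂ) + rsq).re by simp [Complex.mul_re]]
    exact mul_pos Real.pi_pos h
  have := integral_Ioi_cexp_neg_mul ha p
  calc ∫ t : ℝ in Ioi p, cexp (-2 * π * k * t) * cexp (-π * rsq * t)
      = ∫ t : ℝ in Ioi p, cexp (-(π * (2 * k + rsq)) * t) :=
        setIntegral_congr_fun measurableSet_Ioi fun t _ => by rw [← Complex.exp_add]; congr 1; ring
    _ = cexp (-(π * (2 * k + rsq)) * p) / (π * (2 * k + rsq)) := this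
    _ = cexp (-p * π * (2 * k + rsq)) / (π * (2 * k + rsq)) := by congr 2; ring

/-- **CKMRV (5.4), `j = 1`**: `∫_p^∞ (it) e^{−2πkt} e^{−πr²t} dt = i e^{−pπ(2k+r²)}(1 + pπ(2k+r²))/(π²(2k+r²)²)`
for `Re(2k + r²) > 0`. [cite: CohnEtAl2019, §5.1 (5.4)] -/
theorem integral_Ioi_mul_gaussianLaplace {k : ℤ} {rsq : ℂ} (h : 0 < (2 * (k : ℂ) + rsq).re) (p : ℝ) :
    ∫ t : ℝ in Ioi p, (I * t) * (cexp (-2 * π * k * t) * cexp (-π * rsq * t)) =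
      I * cexp (-p * π * (2 * k + rsq)) * (1 + p * π * (2 * k + rsq)) / (π ^ 2 * (2 * k + rsq) ^ 2) := by
  have ha : 0 < ((π : ℂ) * (2 * k + rsq)).re := by
    rw [show ((π : ℂ) * (2 * k + rsq)).re = π * (2 * (k : ℂ) + rsq).re by simp [Complex.mul_re]]
    exact mul_pos Real.pi_pos h
  have := integral_Ioi_mul_cexp_neg_mul ha p
  have heq : (fun t : ℝ => (I * t) * (cexp (-2 * π * k * t) * cexp (-π * rsq * t))) =
      fun t : ℝ => I * ((t : ℂ) * cexp (-(π * (2 * k + rsq)) * t)) := by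
    funext t
    rw [← Complex.exp_add, show -2 * (π : ℂ) * k * t + -π * rsq * t = -(π * (2 * k + rsq)) * t by ring]
    ring
  rw [heq, integral_const_mul, this]
  field_simp

end Literature.Analysis.Fourier
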